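import Summits.BirchSwinnertonDyer.Rank1Residual.X11b.PadicInertiaCharacterLimit
import Literature.NumberTheory.PAdicHodge.PrincipalUnitPowers
import HarnessLib

/-!
# X11b @ `p = 3`, S29 K3 piece (T2), extra: RIGIDITY OF `Hom_cont(ℤ_3ˣ, ℤ_3)` AND THE `∃ β` FORM

HONEST FRAMING (cell `b2b-bsdres`, run/shared/lean/b2b/bsd-rank1-residual/, verbatim in every
file): the goal of the cell is to DELETE the COMBINATION-SHAPED residual classes of the
Birch–Swinnerton-Dyer formula for ALL analytic-rank `≤ 1` elliptic curves over `ℚ` — assembled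
STRICTLY from published theorems — so that the rank-`≤ 1` remainder becomes exactly the
CONSTRUCTION-SHAPED classes, which are TYPED, NOT attempted. This is not "finishing BSD". Team N8/O2
(X11b at `3`: `3 ‖ N`, `r_an = 1`, `E[3]` irreducible); deal S29 (x11b3-lead GEN 8, OWNERS R9-8 /
R9-25 / R9-27), package K3, piece (T2), seat `b2b-bsdres-x11b3-p5` (gen. 6). WORDING OF RECORD (H45,
R9-8): S29 RE-EXPRESSES (t) ⟸ (VR); this file is an UNCONDITIONAL kernel lemma (elementary
`3`-adic analysis) and SUPPLIES NOTHING of the class record by itself; the node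
`Three.HsiehDescentAt₃` is UNCHANGED; O2 OPEN / N8 CONSTRUCTION; nothing booked. THEOREMS ONLY (no
definition, no named fact, no `sorry`). This extra is NOT on the consumer path of K3's assembly
(x11b3-p1, INBOX l.4871, converts the factor `f` of `PadicInertiaCharacterLimit` into an integer
cyclotomic power himself); it records the inventory's (T2) line "`Hom_cont(ℤ_3ˣ, ℤ_3) = ℤ_3·ℓ₀`,
`∃ β, a|_I = β·ℓ₀∘χ_cyc`" in an `ℓ₀`-FREE shape (no `def`): for ANY continuous additive
`ℓ : ℤ_3ˣ → ℤ_3` normalised by `ℓ(4) = 1`.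

## What this file proves

* `exists_pow_sixtyfour_mod_eq`, `exists_pow_sixtyfour_toZModPow_eq` — `64 = 4³ = 1 + 9·7`
  topologically generates `1 + 9ℤ_3` (from the tree's `PrincipalUnitPowers`, `j = 2`).
* `apply_eq_zero_of_toZModPow_two`, **`eq_zero_of_apply_four_eq_zero`** — RIGIDITY: a continuous
  additive `f : ℤ_3ˣ → ℤ_3` with `f(4) = 0` is identically `0`.
* `eq_mul_of_apply_four` — hence `f = f(4)·ℓ` for any continuous additive `ℓ` with `ℓ(4) = 1`.
* **`exists_eq_mul_comp_cyclotomicCharacter`** — for a continuous additive `a : Γ_{ℚ_3} → ℤ_3` and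
  any such normalised `ℓ`: `∃ β : ℤ_3, a(σ) = β·ℓ(χ_3(σ))` for all `σ ∈ I_{ℚ_3}` (with
  `PadicInertiaCharacter.exists_continuous_factor`).  Existence of a normalised `ℓ` is not claimed
  here.

References: J.-P. Serre, *A Course in Arithmetic*, Ch. II §3.2 [`Serre1973`]; *Local Fields*,
Ch. XIV §7 Thm. 2 [`SerreLocalFields1979`]. Cell files: `cells/x11b3/OWNERS.md` R9-25 / R9-27,
`HOME/b2b-bsdres-x11b3-p1/gen3/K3-INVENTORY.md` §(T2).
-/

noncomputable section

open scoped NumberField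
open ValuativeRel Field IsDedekindDomain
open Literature.NumberTheory.GaloisRepresentations Literature.NumberTheory.PAdicHodge

namespace Summit.BirchSwinnertonDyer.Rank1Residual.X11b.Three.InertiaCharacterRigidity

/-! ### §1. `64` topologically generates `1 + 9ℤ_3` -/

/-- **`64 = 4³` generates `1 + 9ℤ/3^M`**: for `M ≥ 2` and `t < 3^{M-2}` some power `64^k` is
`≡ 1 + 9t (mod 3^M)`.  From the tree's reindexing lemma `PrincipalUnitPowers.sum_pow_mod_eq_sum`
(`p = 3`, `j = 2`, `64 = 1 + 3²·7`, `3 ∤ 7`: the residues `64^k mod 3^M`, `k < 3^{M-2}`, are exactly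
the `1 + 9t`, `t < 3^{M-2}`), read with an indicator function.  Serre, *A Course in Arithmetic*,
II §3.2 (structure of `1 + pℤ_p`). [cite: Serre1973, Ch. II §3.2] -/
theorem exists_pow_sixtyfour_mod_eq {M t : ℕ} (hM : 2 ≤ M) (ht : t < 3 ^ (M - 2)) :
    ∃ k : ℕ, 64 ^ k % 3 ^ M = 1 + 9 * t := by
  classical
  have h7 : ¬ (3 ∣ 7) := by decide
  have key := PrincipalUnitPowers.sum_pow_mod_eq_sum (p := 3) Nat.prime_three (j := 2) (M := M)
    le_rfl hM (a := 7) h7 (fun x => if x = 1 + 9 * t then (1 : ℕ) else 0)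
  have h64 : (1 + 3 ^ 2 * 7 : ℕ) = 64 := by norm_num
  simp only [h64] at key
  have hrhs : ∑ x ∈ Finset.range (3 ^ (M - 2)),
      (if 1 + 3 ^ 2 * x = 1 + 9 * t then (1 : ℕ) else 0) = 1 := by
    have : ∀ x, (1 + 3 ^ 2 * x = 1 + 9 * t) ↔ x = t := fun x => by omega
    simp only [this, Finset.sum_ite_eq', Finset.mem_range, ht, if_true]
  rw [hrhs] at key
  by_contra hne
  push Not at hne
  have hlhs : ∑ k ∈ Finset.range (3 ^ (M - 2)),
      (if 64 ^ k % 3 ^ M = 1 + 9 * t then (1 : ℕ) else 0) = 0 :=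
    Finset.sum_eq_zero fun k _ => if_neg (hne k)
  omega

/-- **Every `x ∈ 1 + 9ℤ_3` is a `3`-adic limit of powers of `64`**: for `M ≥ 2` some `64^k` is
`≡ x (mod 3^M)` (`exists_pow_sixtyfour_mod_eq` at the residue `x mod 3^M = 1 + 9t`).
[cite: Serre1973, Ch. II §3.2] -/
theorem exists_pow_sixtyfour_toZModPow_eq (x : ℤ_[3]) (hx : x.toZModPow 2 = 1) (M : ℕ)
    (hM : 2 ≤ M) :
    ∃ k : ℕ, ((64 : ℤ_[3]) ^ k).toZModPow M = x.toZModPow M := by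
  haveI : NeZero (3 ^ M) := ⟨pow_ne_zero _ (by norm_num)⟩
  set r : ℕ := (x.toZModPow M).val with hr
  have hrlt : r < 3 ^ M := ZMod.val_lt _
  -- `r ≡ 1 (mod 9)`
  have hcast :
      (ZMod.castHom (pow_dvd_pow 3 hM) (ZMod (3 ^ 2))) (x.toZModPow M) = x.toZModPow 2 := by
    rw [← RingHom.comp_apply, PadicInt.zmod_cast_comp_toZModPow 2 M hM]
  have hr9 : r % 3 ^ 2 = 1 := by
    have h1 : ((r : ℕ) : ZMod (3 ^ 2)) = 1 := by
      have h2 : (ZMod.castHom (pow_dvd_pow 3 hM) (ZMod (3 ^ 2))) (x.toZModPow M) =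
          ((x.toZModPow M).val : ZMod (3 ^ 2)) := by
        rw [ZMod.castHom_apply, ZMod.cast_eq_val]
      rw [h2, hx] at hcast
      exact hcast
    have := (ZMod.natCast_eq_natCast_iff' r 1 (3 ^ 2)).mp (by rw [Nat.cast_one]; exact h1)
    norm_num at this
    exact this
  obtain ⟨t, ht⟩ : ∃ t, r = 1 + 9 * t := ⟨r / 9, by norm_num at hr9; omega⟩
  have htlt : t < 3 ^ (M - 2) := by
    have h9 : 3 ^ M = 9 * 3 ^ (M - 2) := by
      rw [show (9 : ℕ) = 3 ^ 2 by norm_num, ← pow_add]; congr 1; omega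
    omega
  obtain ⟨k, hk⟩ := exists_pow_sixtyfour_mod_eq hM htlt
  refine ⟨k, ?_⟩
  have h64 : (64 : ℤ_[3]) = ((64 : ℕ) : ℤ_[3]) := by norm_cast
  rw [h64, ← Nat.cast_pow, map_natCast, ← ZMod.natCast_mod, hk, ← ht, hr,
    ZMod.natCast_zmod_val]

/-! ### §2. Rigidity of continuous additive maps `ℤ_3ˣ → ℤ_3` -/

variable (f : ℤ_[3]ˣ → ℤ_[3]) (hmul : ∀ u v, f (u * v) = f u + f v) (hcont : Continuous f)

include hmul in
/-- An additive map `f : ℤ_3ˣ → ℤ_3` (`f (u v) = f u + f v`) satisfies `f (u^n) = n • f u`.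
[folklore] -/
theorem apply_pow_eq_nsmul (u : ℤ_[3]ˣ) (n : ℕ) : f (u ^ n) = n • f u := by
  induction n with
  | zero =>
    have h := hmul 1 1
    rw [mul_one] at h
    rw [pow_zero, zero_smul]
    simpa using h
  | succ n ih => rw [pow_succ, hmul, ih, succ_nsmul]

/-- `4` is a `3`-adic unit. [folklore] -/
theorem isUnit_four : IsUnit (4 : ℤ_[3]) := by
  rw [PadicInt.isUnit_iff]
  have : ((4 : ℕ) : ℤ_[3]) = 4 := by norm_cast
  rw [← this, PadicInt.norm_natCast_eq_one_iff]
  decide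

include hmul hcont in
/-- **A continuous additive `f : ℤ_3ˣ → ℤ_3` vanishing at `4` vanishes on `1 + 9ℤ_3`**: `f` kills
every `64^k = 4^{3k}`, these are dense in `1 + 9ℤ_3` (`exists_pow_sixtyfour_toZModPow_eq`), the
units `ℤ_3ˣ ⊂ ℤ_3` carry the subspace topology (Mathlib `Units.isOpenEmbedding_val`) and `f` is
continuous.  Serre, *A Course in Arithmetic*, II §3.2 (`1 + pℤ_p` is topologically cyclic).
[cite: Serre1973, Ch. II §3.2] -/
theorem apply_eq_zero_of_toZModPow_two (h4 : ∀ u : ℤ_[3]ˣ, (u : ℤ_[3]) = 4 → f u = 0)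
    (x : ℤ_[3]ˣ) (hx : (x : ℤ_[3]).toZModPow 2 = 1) : f x = 0 := by
  set u₄ : ℤ_[3]ˣ := isUnit_four.unit with hu₄
  have hu₄v : (u₄ : ℤ_[3]) = 4 := isUnit_four.unit_spec
  have hf64 : ∀ k : ℕ, f (u₄ ^ (3 * k)) = 0 := fun k => by
    rw [apply_pow_eq_nsmul f hmul, h4 u₄ hu₄v, smul_zero]
  have hval : ∀ k : ℕ, ((u₄ ^ (3 * k) : ℤ_[3]ˣ) : ℤ_[3]) = 64 ^ k := fun k => by
    rw [Units.val_pow_eq_pow_val, hu₄v, pow_mul]; norm_num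
  -- approximate `x` by `64^{k_M}`
  have happrox : ∀ M : ℕ, ∃ k : ℕ,
      ‖((u₄ ^ (3 * k) : ℤ_[3]ˣ) : ℤ_[3]) - x‖ ≤ ((3 : ℕ) : ℝ) ^ (-(M : ℤ)) := by
    intro M
    obtain ⟨k, hk⟩ := exists_pow_sixtyfour_toZModPow_eq x hx (M + 2) (by omega)
    refine ⟨k, ?_⟩
    have h1 : ‖((u₄ ^ (3 * k) : ℤ_[3]ˣ) : ℤ_[3]) - x‖ ≤ ((3 : ℕ) : ℝ) ^ (-((M + 2 : ℕ) : ℤ)) := by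
      rw [hval, PadicInt.norm_le_pow_iff_mem_span_pow, ← PadicInt.ker_toZModPow, RingHom.mem_ker,
        map_sub, sub_eq_zero]
      exact_mod_cast hk
    refine h1.trans (zpow_le_zpow_right₀ (by norm_num) (by push_cast; omega))
  choose k hk using happrox
  have htend : Filter.Tendsto (fun M => ((u₄ ^ (3 * k M) : ℤ_[3]ˣ) : ℤ_[3])) Filter.atTop
      (nhds (x : ℤ_[3])) := by
    refine Metric.tendsto_atTop.mpr fun ε hε => ?_
    obtain ⟨M₀, hM₀⟩ := PadicInt.exists_pow_neg_lt 3 hε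
    refine ⟨M₀, fun M hM => ?_⟩
    rw [dist_eq_norm]
    refine (hk M).trans_lt (lt_of_le_of_lt ?_ hM₀)
    exact zpow_le_zpow_right₀ (by norm_num) (by omega)
  have htend' : Filter.Tendsto (fun M => (u₄ ^ (3 * k M) : ℤ_[3]ˣ)) Filter.atTop (nhds x) := by
    rw [Units.isOpenEmbedding_val.nhds_eq_comap, Filter.tendsto_comap_iff]
    exact htend
  have hlim := (hcont.tendsto x).comp htend'
  have hzero : (fun M => f (u₄ ^ (3 * k M))) = fun _ => 0 := funext fun M => hf64 (k M)
  rw [Function.comp_def, hzero] at hlim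
  exact (tendsto_nhds_unique tendsto_const_nhds hlim).symm

include hmul hcont in
/-- **Rigidity of `Hom_cont(ℤ_3ˣ, ℤ_3)`: a continuous additive `f : ℤ_3ˣ → ℤ_3` with `f(4) = 0` is
zero** — `Hom_cont(ℤ_3ˣ, ℤ_3)` is determined by the value at `4` (so it is free of rank `≤ 1` over
`ℤ_3`; a normalised generator would be "`log` to base `4`", which this file does not need to
construct).  Proof: `u⁶ ∈ 1 + 9ℤ_3` (`#(ℤ/9)ˣ = 6`, Mathlib `ZMod.pow_totient`), so
`6 f(u) = f(u⁶) = 0` by `apply_eq_zero_of_toZModPow_two`, and `ℤ_3` is torsion-free.  The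
hypothesis is phrased `∀ u, ↑u = 4 → f u = 0` so that consumers may bring their own unit with
value `4`.  Serre, *A Course in Arithmetic*, II §3.2 (`ℤ_pˣ ≅ μ_{p-1} × (1 + pℤ_p)`,
`1 + pℤ_p ≅ ℤ_p` for `p` odd). [cite: Serre1973, Ch. II §3.2] -/
theorem eq_zero_of_apply_four_eq_zero (h4 : ∀ u : ℤ_[3]ˣ, (u : ℤ_[3]) = 4 → f u = 0)
    (u : ℤ_[3]ˣ) : f u = 0 := by
  have h6 : ((u ^ 6 : ℤ_[3]ˣ) : ℤ_[3]).toZModPow 2 = 1 := by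
    rw [Units.val_pow_eq_pow_val, map_pow]
    have hu : IsUnit (((u : ℤ_[3]).toZModPow 2)) := (Units.isUnit u).map _
    have htot : Nat.totient (3 ^ 2) = 6 := by decide
    have := ZMod.pow_totient hu.unit
    rw [htot] at this
    have := congrArg (fun z : (ZMod (3 ^ 2))ˣ => (z : ZMod (3 ^ 2))) this
    simpa using this
  have h := apply_eq_zero_of_toZModPow_two f hmul hcont h4 (u ^ 6) h6
  rw [apply_pow_eq_nsmul f hmul, nsmul_eq_mul, mul_eq_zero] at h
  rcases h with h | h
  · exact absurd h (by norm_num)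
  · exact h

/-! ### §3. The normalised form and the `∃ β` statement on inertia -/

include hmul hcont in
/-- **`f = f(4)·ℓ` for any normalised `ℓ`.**  If `f, ℓ : ℤ_3ˣ → ℤ_3` are continuous and additive
and `ℓ(u₄) = 1` for the unit `u₄` with `↑u₄ = 4`, then `f(u) = f(u₄)·ℓ(u)` for all `u`
(`eq_zero_of_apply_four_eq_zero` applied to `f − f(u₄)·ℓ`). [cite: Serre1973, Ch. II §3.2] -/
theorem eq_mul_of_apply_four (ℓ : ℤ_[3]ˣ → ℤ_[3]) (hℓmul : ∀ u v, ℓ (u * v) = ℓ u + ℓ v)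
    (hℓcont : Continuous ℓ) (u₄ : ℤ_[3]ˣ) (hu₄ : (u₄ : ℤ_[3]) = 4) (hℓ : ℓ u₄ = 1)
    (u : ℤ_[3]ˣ) : f u = f u₄ * ℓ u := by
  set g : ℤ_[3]ˣ → ℤ_[3] := fun w => f w - f u₄ * ℓ w with hg
  have hgmul : ∀ w w', g (w * w') = g w + g w' := fun w w' => by
    simp only [hg, hmul, hℓmul]; ring
  have hgcont : Continuous g := hcont.sub (continuous_const.mul hℓcont)
  have hg4 : ∀ w : ℤ_[3]ˣ, (w : ℤ_[3]) = 4 → g w = 0 := fun w hw => by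
    have hw' : w = u₄ := Units.ext (by rw [hw, hu₄])
    simp only [hg, hw', hℓ, mul_one, sub_self]
  have h := eq_zero_of_apply_four_eq_zero g hgmul hgcont hg4 u
  simp only [hg] at h
  exact sub_eq_zero.mp h

/-- **The inventory's (T2) line, `ℓ₀`-free** (S29 K3, `K3-INVENTORY.md` §(T2): "for every
continuous hom `a : Γ_{ℚ_3} → ℤ_3` there is `β ∈ ℤ_3` with `(a − β·ℓ₀∘χ_cyc)|_I = 0`").  Let
`a : Γ_{ℚ_3} → ℤ_3` be continuous and additive, and let `ℓ : ℤ_3ˣ → ℤ_3` be ANY continuous additive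
map normalised by `ℓ(u₄) = 1`, `↑u₄ = 4` (all such `ℓ` coincide by `eq_mul_of_apply_four`).  Then
there is `β : ℤ_3` with `a(σ) = β · ℓ(χ_3(σ))` for every `σ` in the inertia group `I_{ℚ_3}`:
`a|_I = f ∘ χ_3|_I` (`PadicInertiaCharacter.exists_continuous_factor`, Serre XIV §7 Thm. 2) and
`f = f(4)·ℓ`.  (The tree's Prop-valued local-field structure on `ℚ_[3]` is an instance binder,
discharged by `Padic.isNonarchimedeanLocalField_holds 3`.)
[cite: SerreLocalFields1979, Ch. XIV §7 Thm. 2] [cite: Serre1973, Ch. II §3.2] -/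
theorem exists_eq_mul_comp_cyclotomicCharacter [IsNonarchimedeanLocalField ℚ_[3]]
    (a : absoluteGaloisGroup ℚ_[3] → ℤ_[3]) (hamul : ∀ σ τ, a (σ * τ) = a σ + a τ)
    (hacont : Continuous a)
    (ℓ : ℤ_[3]ˣ → ℤ_[3]) (hℓmul : ∀ u v, ℓ (u * v) = ℓ u + ℓ v) (hℓcont : Continuous ℓ)
    (u₄ : ℤ_[3]ˣ) (hu₄ : (u₄ : ℤ_[3]) = 4) (hℓ : ℓ u₄ = 1) :
    ∃ β : ℤ_[3], ∀ σ ∈ absInertia ℚ_[3],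
      a σ = β * ℓ (GaloisRep.cyclotomicCharacter ℚ_[3] 3 σ) := by
  obtain ⟨f, hfcont, hfmul, hf⟩ := PadicInertiaCharacter.exists_continuous_factor 3 a hamul hacont
  refine ⟨f u₄, fun σ hσ => ?_⟩
  rw [hf σ hσ]
  exact eq_mul_of_apply_four f hfmul hfcont ℓ hℓmul hℓcont u₄ hu₄ hℓ _

end Summit.BirchSwinnertonDyer.Rank1Residual.X11b.Three.InertiaCharacterRigidity
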